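import Literature.MathematicalPhysics.QuantumFieldTheory.Balaban1983to89.Node00.OpsYSiteKernelPair

/-!
# NODE 00 — the UNIT-LATTICE DISTANCE under MODULE A's embedding (`unitDistY x⁺ (ι y) (ι y′) = unitDistY x y y′`) and the `Kunit` floor face WITHOUT `hD`

[B9] = Bałaban, *Propagators for lattice gauge theories in a background field*, CMP 99 (1985) 389–434, Thm 3.15 (3.187) p.432 («|y − y′|, y, y′ ∈ Λ ⊂ T₁^{(k)}»,
«η = L^{−k}» p.391); [K] = King, CMP 102 (1986) 649–677, p.664 (the pairing «run A at η, run B at η′ = L^{−n}η»), Lemma 4.5 (4.38) p.674.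

WHY THIS FILE (this seat's FILE 44 `Node00.OpsYSiteKernelPair`, successor item «unitDistY_ιY»).  FILE 44's θ = 1 floor face for N15's `Kunit` slot,
`etaRateIneqUnit_one_siteKernelS₂Y_of_bounds`, displays the distance transfer `hD : y, y′ ∈ Λ → unitDistY x y y′ ≤ unitDistY x⁺ (ι y) (ι y′)`; by FILE 44's
`kLab_ιY` both sides are the torus sup-distances `tdistK` of the SAME `k`-block labels, on `T^{(k+n)}` of run B (periods `Lⁿ·N0`, lattice unit `L^{k+n}`) resp.
`T^{(k)}` of run A (periods `N0`, unit `L^k`).  THIS FILE proves their EQUALITY — the `Lⁿ`-homogeneity of Mathlib's `AddCircle` quotient norm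
(`AddCircle.norm_coe_mul`) coordinate by coordinate under the sup metric — and re-issues the floor face with `hD` DISCHARGED.
* §1 `norm_coe_mul_of_eq` (`‖(t·x : AddCircle q)‖ = |t|·‖(x : AddCircle p)‖` for `q = t·p`), ★ `dist_toT_eq_mul` (the torus sup-distance of `Π_μ ℝ∕N′_μℤ` at
  `t`-scaled differences with `N′ = t·N` is `t`× that of `Π_μ ℝ∕N_μℤ`), ★ `tdistK_level_add` (`tdistK` at `(Mh, k + n, P)` = `tdistK` at `(Mh, k, P)` on the same labels:
  `N0_add`, `cenLab` differences scale by `L^{k+n} = Lⁿ·L^k`);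
* §2 ★★ `unitDistY_ιY : inΛY x y → inΛY x y′ → unitDistY (refineY x n) (ιY x n y) (ιY x n y′) = unitDistY x y y′`;
* §3 ★★ `etaRateIneqUnit_one_siteKernelS₂Y_of_bounds′` — FILE 44's `Kunit` floor face with `hD` supplied by §2 (only the two members' (3.187)-shaped majorants remain
  as hypotheses; θ = 1, no gain — [K] (4.38)'s `θ = L^{−1}` is N15's content, NOT asserted).
HONEST SCOPE.  Elementary metric bookkeeping (Mathlib's `AddCircle`, the `Π`-sup metric) over def-Y's MODULE A; nothing of [B9] Thm 3.15 or of [K] Lemma 4.5 or of NE2⁺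
asserted; COUNT-NEUTRAL; N15 ∕ N06 NOT discharged; one finite 𝕋⁴ programme at fixed ε — nothing continuum, nothing about the mass gap.  Cell `pub-ymgap` (HUMAN
RULING D-0062), Track A node N15, seat `pub-ymgap-node00-def-Y` (g22), 2026-08-28.
-/

namespace Literature.MathematicalPhysics.QuantumFieldTheory.Balaban1983to89.Node00.OpsYSiteKernelPairUnit

open B6Ineq2142KLevelV1 (β)
open B6MultiLevelBoxOperator (N0)
open B6Geom246MultiLevelTorus (toT)
open B9Thm314GpFlatTorusGeometry (tdistK cenLab)
open B9PinMembersKLevelV1 (MemberY geo9Y bg9Y)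
open B9PinGeometryKLevelV1 (inΛY unitDistY kLab)
open Node00.MemberYRefineDomains (N0_add)
open Node00.MemberYRefine (refineY ιY)
open Node00.OpsYSiteKernelPair (kLab_ιY siteKernelS₂Y BlkLetterY etaRateIneqUnit_one_siteKernelS₂Y_of_bounds)
open T4EtaRate (EtaRateIneqUnit)

noncomputable section

variable {d : ℕ}

/-! ## §1 The `Lⁿ`-homogeneity of the torus sup-distance -/

/-- `‖(t·x : ℝ∕qℤ)‖ = |t|·‖(x : ℝ∕pℤ)‖` for `q = t·p` (Mathlib's `AddCircle.norm_coe_mul` with the period rewritten). [cite: Balaban1985BackgroundPropagators, p.391 («η = L^{−k}», rescaling), dictionary] -/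
theorem norm_coe_mul_of_eq {p q t : ℝ} (h : q = t * p) (x : ℝ) : ‖((t * x : ℝ) : AddCircle q)‖ = |t| * ‖((x : ℝ) : AddCircle p)‖ := by
  subst h
  exact AddCircle.norm_coe_mul p x t

/-- ★ **the torus sup-distance is homogeneous**: on `Π_μ ℝ∕N′_μℤ` with `N′ = t·N`, points whose coordinate differences are `t`× those of two points of `Π_μ ℝ∕N_μℤ`
are at `t`× the distance. [cite: Balaban1985BackgroundPropagators, p.391 («η = L^{−k}»), (3.187) p.432; King1986, p.664 (η′ = L^{−n}η), dictionary] -/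
theorem dist_toT_eq_mul {N N' : Fin (d + 1) → ℕ} {t : ℝ} (ht : 0 < t) (hN : ∀ μ, ((N' μ : ℕ) : ℝ) = t * ((N μ : ℕ) : ℝ))
    {u v u' v' : Fin (d + 1) → ℝ} (hu : ∀ μ, u' μ - v' μ = t * (u μ - v μ)) :
    dist (toT N' u') (toT N' v') = t * dist (toT N u) (toT N v) := by
  have hc : ∀ μ, dist (toT N' u' μ) (toT N' v' μ) = t * dist (toT N u μ) (toT N v μ) := by
    intro μ
    rw [dist_eq_norm, dist_eq_norm, toT, toT, ← AddCircle.coe_sub, toT, toT, ← AddCircle.coe_sub, hu μ, norm_coe_mul_of_eq (hN μ),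
      abs_of_pos ht]
  refine le_antisymm ((dist_pi_le_iff (mul_nonneg ht.le dist_nonneg)).2 fun μ => ?_) ?_
  · rw [hc μ]
    exact mul_le_mul_of_nonneg_left (dist_le_pi_dist _ _ μ) ht.le
  · rw [mul_comm, ← le_div_iff₀ ht]
    refine (dist_pi_le_iff (div_nonneg dist_nonneg ht.le)).2 fun μ => ?_
    rw [le_div_iff₀ ht, mul_comm, ← hc μ]
    exact dist_le_pi_dist _ _ μ

/-- ★ **`tdistK` one pairing deeper is `tdistK`**: the unit-lattice distance of two `k`-block labels read on `T^{(k+n)}` (periods `Lⁿ·N0`, unit `L^{k+n}`) equals the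
one read on `T^{(k)}` (periods `N0`, unit `L^k`). [cite: Balaban1985BackgroundPropagators, (3.154) p.427, (3.187) p.432, p.391; King1986, p.664] -/
theorem tdistK_level_add (ℓ Mh k n : ℕ) (P : Fin (d + 1) → ℕ) (b b' : Fin (d + 1) → ℤ) :
    tdistK (ℓ := ℓ) (Mh := Mh) (k := k + n) (P := P) b b' = tdistK (ℓ := ℓ) (Mh := Mh) (k := k) (P := P) b b' := by
  have ht : (0 : ℝ) < ((ℓ + 1 : ℕ) : ℝ) ^ n := by positivity
  have hN : ∀ μ, ((N0 ℓ Mh (k + n) P μ : ℕ) : ℝ) = ((ℓ + 1 : ℕ) : ℝ) ^ n * ((N0 ℓ Mh k P μ : ℕ) : ℝ) := fun μ => by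
    rw [N0_add]; push_cast; ring
  have hu : ∀ μ, cenLab ((ℓ + 1) ^ (k + n)) b μ - cenLab ((ℓ + 1) ^ (k + n)) b' μ =
      ((ℓ + 1 : ℕ) : ℝ) ^ n * (cenLab ((ℓ + 1) ^ k) b μ - cenLab ((ℓ + 1) ^ k) b' μ) := fun μ => by
    simp only [cenLab]; push_cast; ring
  unfold tdistK
  rw [dist_toT_eq_mul ht hN hu]
  have hL : (((ℓ + 1) ^ (k + n) : ℕ) : ℝ) = ((ℓ + 1 : ℕ) : ℝ) ^ n * (((ℓ + 1) ^ k : ℕ) : ℝ) := by push_cast; ring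
  rw [hL, mul_div_mul_left _ _ ht.ne']

/-! ## §2 At a member of record: `unitDistY x⁺ (ι y) (ι y′) = unitDistY x y y′` on `Λ` -/

variable {ℓ : ℕ} {hd : 1 ≤ d + 1} {hL : Odd (ℓ + 1) ∧ 1 < ℓ + 1} {b₀ b₁ : ℝ} {Mstar : ℕ}

/-- ★★ **THE UNIT-LATTICE DISTANCE IS PRESERVED BY MODULE A's EMBEDDING** (on Thm 3.15's region `Λ`): `|ι y − ι y′|_{T₁^{(k+n)}} = |y − y′|_{T₁^{(k)}}`
(FILE 44's `kLab_ιY` + §1's `tdistK_level_add`). [cite: Balaban1985BackgroundPropagators, Thm 3.15 (3.187) p.432; King1986, p.664, Lemma 4.5 (4.38) p.674] -/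
theorem unitDistY_ιY (x : MemberY d ℓ hd hL b₀ b₁ Mstar) (n : ℕ) {c c' : (geo9Y x).Site} (h : inΛY x c) (h' : inΛY x c') :
    unitDistY (refineY x n) (ιY x n c) (ιY x n c') = unitDistY x c c' := by
  unfold unitDistY
  rw [kLab_ιY x n h, kLab_ιY x n h']
  exact tdistK_level_add ℓ x.Mh x.k n x.P' (kLab x c) (kLab x c')

/-! ## §3 The `Kunit` floor face with `hD` discharged -/

variable {𝔸 : Type} [NormedRing 𝔸] [NormedAlgebra ℂ 𝔸] [CompleteSpace 𝔸]
variable {ι : Type} [Fintype ι] (b : Module.Basis ι ℝ 𝔸) {M₂ : ℝ}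
variable {G : Subgroup 𝔸ˣ} {x : MemberY d ℓ hd hL b₀ b₁ Mstar} {n : ℕ} {avg : CfgY 𝔸 (refineY x n).toKIdx → CfgY 𝔸 x.toKIdx}

/-- ★★ **THE FLOOR FACE FOR `Kunit` AT `θ = 1`, `hD` DISCHARGED**: the (3.187)-shaped unit-lattice majorants of the two members — `|ker⁺ U′ z z′| ≤ B₁e^{−δ₀|z−z′|}` on `Λ⁺`,
`|ker (avg U′) y y′| ≤ B₂e^{−δ₀|y−y′|}` on `Λ` — give `EtaRateIneqUnit (siteKernelS₂Y …) (inΛY x) (unitDistY x) (B₁ + B₂) δ₀ 1 k U′` (FILE 44's face with the region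
transfer `inΛY_ιY_iff` and, now, the distance transfer `unitDistY_ιY`). [K] (4.38)'s gain `θ = L^{−1}` is N15's content, NOT asserted.
[cite: Balaban1985BackgroundPropagators, Thm 3.15 (3.187) p.432; King1986, Lemma 4.5 (4.38) p.674 (θ-template)] -/
theorem etaRateIneqUnit_one_siteKernelS₂Y_of_bounds' (hM₂ : 0 ≤ M₂) (hrepr : ∀ (v : 𝔸) (j : ι), |b.repr v j| ≤ M₂ * ‖v‖)
    (Of : BlkLetterY 𝔸 (refineY x n).toKIdx) (Oc : BlkLetterY 𝔸 x.toKIdx) {B₁ B₂ δ₀ : ℝ} (hB₁ : 0 ≤ B₁) (hδ : 0 ≤ δ₀) (k : ℕ)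
    {U' : CfgY 𝔸 (refineY x n).toKIdx}
    (hf : ∀ z z' : (geo9Y (refineY x n)).Site, inΛY (refineY x n) z → inΛY (refineY x n) z' →
      |(siteKernelOfOp (refineY x n).toKIdx (bg9Y 𝔸 G (refineY x n)) (fun U => U) Of
          (β (refineY x n).hN (refineY x n).D (refineY x n).hk) (β (refineY x n).hN (refineY x n).D (refineY x n).hk)).ker U' z z'| ≤
        B₁ * Real.exp (-(δ₀ * unitDistY (refineY x n) z z')))
    (hc : ∀ y y' : (geo9Y x).Site, inΛY x y → inΛY x y' →
      |(siteKernelOfOp x.toKIdx (bg9Y 𝔸 G x) (fun U => U) Oc (β x.hN x.D x.hk) (β x.hN x.D x.hk)).ker (avg U') y y'| ≤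
        B₂ * Real.exp (-(δ₀ * unitDistY x y y'))) :
    EtaRateIneqUnit (siteKernelS₂Y G x n avg Of Oc) (inΛY x) (unitDistY x) (B₁ + B₂) δ₀ 1 k U' :=
  etaRateIneqUnit_one_siteKernelS₂Y_of_bounds b hM₂ hrepr Of Oc hB₁ hδ k
    (fun _ _ hy hy' => (unitDistY_ιY x n hy hy').ge) hf hc

end

end Literature.MathematicalPhysics.QuantumFieldTheory.Balaban1983to89.Node00.OpsYSiteKernelPairUnit
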